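import Literature.MathematicalPhysics.QuantumManyBody.PeriodicBoseGasEq317
import Mathlib.MeasureTheory.Function.Jacobian
import Mathlib.MeasureTheory.Group.FundamentalDomain
import HarnessLib

/-!
# Change of variables on the flat torus for lattice-equivariant `C¹` diffeomorphisms

Topic `Literature/MathematicalPhysics/QuantumManyBody`, vocabulary of `PeriodicBoseGas.lean`
(`Config N = (ℝ³)^N`, the fundamental cell `cellN N L = [0,L)^{3N}` of the torus `(ℝ³/Lℤ³)^N`).

Let `L > 0` and let `F : (ℝ³)^N → (ℝ³)^N` be a bijection, differentiable everywhere with Fréchet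
derivative `F' X`, which commutes with the generators of the period lattice `Γ = (Lℤ³)^N`:
`F (X + L e_{i,c}) = F X + L e_{i,c}` for every particle `i` and axis `c`. Then `F` descends to a
differentiable bijection of the flat torus `(ℝ³/Lℤ³)^N` (a `C¹` diffeomorphism in the
applications; neither continuity nor invertibility of `F'` is used), and for every `Γ`-periodic
`G ≥ 0`

  `∫_{[0,L)^{3N}} G (F X) |det F'(X)| dX = ∫_{[0,L)^{3N}} G (X) dX`

(`lintegral_cellN_comp_equivariant`), with the Bochner twin `integral_cellN_comp_equivariant`
(`∫_cell |det F'| • (G ∘ F) = ∫_cell G`, values in a real normed space, no integrability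
hypothesis: both sides vanish together when `G` is not integrable on the cell) and the transfer of
integrability `integrableOn_cellN_comp_equivariant_iff`. Everything is first proved for an
arbitrary lattice `ℤ b`, `b` a basis of a finite-dimensional real normed space `E` with an additive
Haar measure, on the fundamental parallelepiped `ZSpan.fundamentalDomain b = {∑ tᵢ bᵢ | 0 ≤ tᵢ < 1}`
(`lintegral_fundamentalDomain_comp_equivariant` etc.), and then specialised to the basis
`(L e_{i,c})` of `(ℝ³)^N`, whose parallelepiped is the cell (`fundamentalDomain_latticeBasisN` of
`PeriodicBoseGasEq317.lean`).

## The argument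

1. Euclidean change of variables on the measurable set `P = fundamentalDomain b` (Mathlib,
   `lintegral_image_eq_lintegral_abs_det_fderiv_mul`: injectivity and differentiability on the
   set suffice): `∫_{F(P)} G = ∫_P |det F'| (G ∘ F)`.
2. `F(P)` is again a fundamental domain of `ℤ b` acting on `E` by translations
   (`isAddFundamentalDomain_image_fundamentalDomain`): equivariance extends from the generators
   to the subgroup they generate (`apply_add_of_mem_closure_of_equivariant`), so the orbit of
   `x = F y` meets `F(P)` exactly in `F (γ + y)` for the unique `γ ∈ ℤ b` with `γ + y ∈ P`
   (`ZSpan.exist_unique_vadd_mem_fundamentalDomain`); the image is Borel by Lusin–Souslin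
   (`MeasurableSet.image_of_continuousOn_injOn`).
3. Integrals of `ℤ b`-invariant functions over two fundamental domains agree
   (`IsAddFundamentalDomain.setLIntegral_eq` / `setIntegral_eq`): `∫_{F(P)} G = ∫_P G`.

This is the standard change-of-variables formula on the compact manifold `E/ℤ b` written on a
fundamental cell (folklore); on `(ℝ³/Lℤ³)^N` it is what normalises wave functions transported
along lattice-periodic flows of the periodic box of [LSSY2005, Ch. 2, Thm. 2.2] (periodic
boundary conditions, `PeriodicTrialState` of `PeriodicBoseGas.lean`). No measurability or
integrability hypothesis on `G` is needed (Mathlib's Jacobian formula is stated for arbitrary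
`G ≥ 0`, and the fundamental-domain comparison only uses invariance). The invariance of periodic
functions of arbitrary type along the generated subgroup (`apply_add_of_mem_closure_of_periodic`)
is the general form of `periodic_closure` (`PeriodicBoseGasEq317.lean`, `ℝ≥0∞`-valued) and of
`apply_add_of_mem_latticeClosure` (`PeriodicHeatFlowSpectralProofs.lean`, the `(ℝ³)^N` lattice),
restated for an arbitrary family of periods so that this file does not import the Feynman–Kac
development. Deliberately NOT here: any statement about particular flows, permutation symmetry,
or `Lᵖ` versions.

## References

* [LSSY2005] E. H. Lieb, R. Seiringer, J. P. Solovej, J. Yngvason, *The Mathematics of the Bose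
  Gas and its Condensation*, Oberwolfach Seminars 34, Birkhäuser (2005) (periodic boundary
  conditions on the box `[0,L]³`).
-/

noncomputable section

open MeasureTheory Filter Set
open scoped ENNReal NNReal Topology Pointwise

namespace Literature.MathematicalPhysics.QuantumManyBody.BoseGas

/-! ### Periodicity and equivariance along the subgroup generated by the periods -/

section Closure

variable {ι V β : Type*} [AddCommGroup V] (v : ι → V)

/-- A function (with values in any type) invariant under the translations by a family of
vectors `v i` is invariant under the subgroup they generate. [folklore] -/
theorem apply_add_of_mem_closure_of_periodic {G : V → β}
    (hG : ∀ (x : V) (i : ι), G (x + v i) = G x)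
    {g : V} (hg : g ∈ AddSubgroup.closure (Set.range v)) (x : V) : G (g + x) = G x := by
  induction hg using AddSubgroup.closure_induction generalizing x with
  | mem w hw =>
      obtain ⟨i, rfl⟩ := hw
      rw [add_comm]
      exact hG x i
  | zero => rw [zero_add]
  | add w w' _ _ ihw ihw' => rw [add_assoc, ihw, ihw']
  | neg w _ ihw =>
      have h := ihw (-w + x)
      rw [← add_assoc, add_neg_cancel, zero_add] at h
      exact h.symm

/-- A self-map commuting with the translations by a family of vectors `v i` commutes with every
translation of the subgroup they generate: `F (g + x) = g + F x` (equivariance of `F` is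
periodicity of `F - id`). [folklore] -/
theorem apply_add_of_mem_closure_of_equivariant {F : V → V}
    (hF : ∀ (x : V) (i : ι), F (x + v i) = F x + v i)
    {g : V} (hg : g ∈ AddSubgroup.closure (Set.range v)) (x : V) : F (g + x) = g + F x := by
  have h := apply_add_of_mem_closure_of_periodic v (G := fun x => F x - x)
    (fun x i => by rw [hF, add_sub_add_right_eq_sub]) hg x
  calc F (g + x) = F x - x + (g + x) := sub_eq_iff_eq_add.1 h
    _ = g + F x := by abel

end Closure

/-! ### Lattices `ℤ b`: the image of the fundamental parallelepiped is a fundamental domain -/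

section Lattice

variable {ι E : Type*} [NormedAddCommGroup E] [NormedSpace ℝ E] (b : Module.Basis ι ℝ E)

/-- A function periodic under the basis vectors is invariant under the translation action of
the lattice `ℤ b`. [folklore] -/
theorem apply_vadd_of_periodic {β : Type*} {G : E → β} (hG : ∀ (x : E) (i : ι), G (x + b i) = G x)
    (g : (Submodule.span ℤ (Set.range b)).toAddSubgroup) (x : E) : G (g +ᵥ x) = G x := by
  rw [AddSubgroup.vadd_def, vadd_eq_add]
  refine apply_add_of_mem_closure_of_periodic b hG ?_ x
  rw [← Submodule.span_int_eq_addSubgroupClosure]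
  exact g.2

/-- A self-map commuting with the translations by the basis vectors commutes with the
translation action of the lattice `ℤ b`: `F (g +ᵥ x) = g +ᵥ F x`. [folklore] -/
theorem apply_vadd_of_equivariant {F : E → E} (hF : ∀ (x : E) (i : ι), F (x + b i) = F x + b i)
    (g : (Submodule.span ℤ (Set.range b)).toAddSubgroup) (x : E) : F (g +ᵥ x) = g +ᵥ F x := by
  rw [AddSubgroup.vadd_def, AddSubgroup.vadd_def, vadd_eq_add, vadd_eq_add]
  refine apply_add_of_mem_closure_of_equivariant b hF ?_ x
  rw [← Submodule.span_int_eq_addSubgroupClosure]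
  exact g.2

variable [Finite ι] [FiniteDimensional ℝ E] [MeasurableSpace E] [BorelSpace E]

/-- **The image of the fundamental parallelepiped under a lattice-equivariant continuous
bijection is a fundamental domain** of the lattice `ℤ b` (for any measure): the orbit of `F y`
meets `F(P)`, `P = {∑ tᵢ bᵢ | 0 ≤ tᵢ < 1}`, exactly in `F (γ + y)` for the unique `γ ∈ ℤ b` with
`γ + y ∈ P`; the image is Borel by the Lusin–Souslin theorem. [folklore] -/
theorem isAddFundamentalDomain_image_fundamentalDomain (μ : Measure E) {F : E → E}
    (hcont : Continuous F) (hbij : Function.Bijective F)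
    (hequiv : ∀ (x : E) (i : ι), F (x + b i) = F x + b i) :
    IsAddFundamentalDomain (Submodule.span ℤ (Set.range b)).toAddSubgroup
      (F '' ZSpan.fundamentalDomain b) μ := by
  refine IsAddFundamentalDomain.mk'
    ((ZSpan.fundamentalDomain_measurableSet b).image_of_continuousOn_injOn hcont.continuousOn
      hbij.1.injOn).nullMeasurableSet fun x => ?_
  obtain ⟨y, rfl⟩ := hbij.2 x
  obtain ⟨v, hv, huniq⟩ := ZSpan.exist_unique_vadd_mem_fundamentalDomain b y
  refine ⟨v, ⟨v +ᵥ y, hv, apply_vadd_of_equivariant b hequiv v y⟩, fun w hw => huniq w ?_⟩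
  obtain ⟨z, hz, hzw⟩ := hw
  rw [← apply_vadd_of_equivariant b hequiv w y] at hzw
  change w +ᵥ y ∈ ZSpan.fundamentalDomain b
  rw [← hbij.1 hzw]
  exact hz

variable (μ : Measure E) [Measure.IsAddHaarMeasure μ]

/-- Integrals of a lattice-periodic `G ≥ 0` over the fundamental parallelepiped and over its
image under a lattice-equivariant continuous bijection agree (two fundamental domains of `ℤ b`,
translation-invariant measure). [folklore] -/
theorem setLIntegral_image_fundamentalDomain {F : E → E}
    (hcont : Continuous F) (hbij : Function.Bijective F)
    (hequiv : ∀ (x : E) (i : ι), F (x + b i) = F x + b i) {G : E → ℝ≥0∞}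
    (hper : ∀ (x : E) (i : ι), G (x + b i) = G x) :
    ∫⁻ x in F '' ZSpan.fundamentalDomain b, G x ∂μ = ∫⁻ x in ZSpan.fundamentalDomain b, G x ∂μ := by
  haveI : Countable (Submodule.span ℤ (Set.range b)).toAddSubgroup := by
    change Countable (Submodule.span ℤ (Set.range b))
    infer_instance
  exact (isAddFundamentalDomain_image_fundamentalDomain b μ hcont hbij hequiv).setLIntegral_eq
    (ZSpan.isAddFundamentalDomain' b μ) G (apply_vadd_of_periodic b hper)

/-- **Change of variables on the torus `E/ℤ b`** (`ℝ≥0∞` form): for a bijection `F` of `E` with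
Fréchet derivative `F' x` at every `x`, commuting with the translations by the basis vectors,
and a lattice-periodic `G ≥ 0`, `∫_P G (F x) |det F'(x)| dμ = ∫_P G dμ` on the fundamental
parallelepiped `P` (`μ` an additive Haar measure). [folklore] -/
theorem lintegral_fundamentalDomain_comp_equivariant {F : E → E} {F' : E → E →L[ℝ] E}
    (hF : ∀ x, HasFDerivAt F (F' x) x) (hbij : Function.Bijective F)
    (hequiv : ∀ (x : E) (i : ι), F (x + b i) = F x + b i) {G : E → ℝ≥0∞}
    (hper : ∀ (x : E) (i : ι), G (x + b i) = G x) :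
    ∫⁻ x in ZSpan.fundamentalDomain b, G (F x) * ENNReal.ofReal |(F' x).det| ∂μ =
      ∫⁻ x in ZSpan.fundamentalDomain b, G x ∂μ := by
  have hcont : Continuous F := continuous_iff_continuousAt.2 fun x => (hF x).continuousAt
  rw [← setLIntegral_image_fundamentalDomain b μ hcont hbij hequiv hper,
    lintegral_image_eq_lintegral_abs_det_fderiv_mul μ (ZSpan.fundamentalDomain_measurableSet b)
      (fun x _ => (hF x).hasFDerivWithinAt) hbij.1.injOn G]
  simp_rw [mul_comm (G _)]

/-- Transfer of integrability under the torus change of variables: for lattice-periodic `G`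
with values in a real normed space, `|det F'| • (G ∘ F)` is integrable on the fundamental
parallelepiped iff `G` is. [folklore] -/
theorem integrableOn_fundamentalDomain_comp_equivariant_iff {F : E → E} {F' : E → E →L[ℝ] E}
    (hF : ∀ x, HasFDerivAt F (F' x) x) (hbij : Function.Bijective F)
    (hequiv : ∀ (x : E) (i : ι), F (x + b i) = F x + b i)
    {W : Type*} [NormedAddCommGroup W] [NormedSpace ℝ W] {G : E → W}
    (hper : ∀ (x : E) (i : ι), G (x + b i) = G x) :
    IntegrableOn (fun x => |(F' x).det| • G (F x)) (ZSpan.fundamentalDomain b) μ ↔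
      IntegrableOn G (ZSpan.fundamentalDomain b) μ := by
  haveI : Countable (Submodule.span ℤ (Set.range b)).toAddSubgroup := by
    change Countable (Submodule.span ℤ (Set.range b))
    infer_instance
  have hcont : Continuous F := continuous_iff_continuousAt.2 fun x => (hF x).continuousAt
  rw [← integrableOn_image_iff_integrableOn_abs_det_fderiv_smul μ
      (ZSpan.fundamentalDomain_measurableSet b) (fun x _ => (hF x).hasFDerivWithinAt)
      hbij.1.injOn G]
  exact (isAddFundamentalDomain_image_fundamentalDomain b μ hcont hbij hequiv).integrableOn_iff
    (ZSpan.isAddFundamentalDomain' b μ) (apply_vadd_of_periodic b hper)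

/-- **Change of variables on the torus `E/ℤ b`** (Bochner form): for a lattice-equivariant
bijection `F` of `E` with Fréchet derivative `F' x` at every `x` and a lattice-periodic `G` with
values in a real normed space, `∫_P |det F'(x)| • G (F x) dμ = ∫_P G dμ` on the fundamental
parallelepiped `P` (no integrability hypothesis: both sides are `0` when `G` is not integrable on
`P`, by `integrableOn_fundamentalDomain_comp_equivariant_iff`). [folklore] -/
theorem integral_fundamentalDomain_comp_equivariant {F : E → E} {F' : E → E →L[ℝ] E}
    (hF : ∀ x, HasFDerivAt F (F' x) x) (hbij : Function.Bijective F)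
    (hequiv : ∀ (x : E) (i : ι), F (x + b i) = F x + b i)
    {W : Type*} [NormedAddCommGroup W] [NormedSpace ℝ W] {G : E → W}
    (hper : ∀ (x : E) (i : ι), G (x + b i) = G x) :
    ∫ x in ZSpan.fundamentalDomain b, |(F' x).det| • G (F x) ∂μ =
      ∫ x in ZSpan.fundamentalDomain b, G x ∂μ := by
  haveI : Countable (Submodule.span ℤ (Set.range b)).toAddSubgroup := by
    change Countable (Submodule.span ℤ (Set.range b))
    infer_instance
  have hcont : Continuous F := continuous_iff_continuousAt.2 fun x => (hF x).continuousAt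
  rw [← integral_image_eq_integral_abs_det_fderiv_smul μ (ZSpan.fundamentalDomain_measurableSet b)
      (fun x _ => (hF x).hasFDerivWithinAt) hbij.1.injOn G]
  exact (isAddFundamentalDomain_image_fundamentalDomain b μ hcont hbij hequiv).setIntegral_eq
    (ZSpan.isAddFundamentalDomain' b μ) (apply_vadd_of_periodic b hper)

end Lattice

/-! ### The flat torus `(ℝ³/Lℤ³)^N`: change of variables on the cell `[0,L)^{3N}` -/

section Cell

variable {N : ℕ} {L : ℝ}

/-- **Change of variables on the flat torus** (`ℝ≥0∞` form). Let `L > 0`, let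
`F : (ℝ³)^N → (ℝ³)^N` be a bijection with Fréchet derivative `F' X` at every `X`, commuting with
the period translations, `F (X + L e_{i,c}) = F X + L e_{i,c}`, and let `G ≥ 0` be lattice
periodic. Then `∫_{[0,L)^{3N}} G (F X) |det F'(X)| dX = ∫_{[0,L)^{3N}} G`: the change-of-variables
formula for the induced differentiable bijection of `(ℝ³/Lℤ³)^N`, written on the fundamental
cell. [folklore] -/
theorem lintegral_cellN_comp_equivariant (hL : 0 < L) {F : Config N → Config N}
    {F' : Config N → (Config N →L[ℝ] Config N)} (hF : ∀ X, HasFDerivAt F (F' X) X)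
    (hbij : Function.Bijective F)
    (hequiv : ∀ (X : Config N) (i : Fin N) (c : Fin 3),
      F (X + Pi.single i (EuclideanSpace.single c L)) =
        F X + Pi.single i (EuclideanSpace.single c L))
    {G : Config N → ℝ≥0∞}
    (hper : ∀ (X : Config N) (i : Fin N) (c : Fin 3),
      G (X + Pi.single i (EuclideanSpace.single c L)) = G X) :
    ∫⁻ X in cellN N L, G (F X) * ENNReal.ofReal |(F' X).det| = ∫⁻ X in cellN N L, G X := by
  rw [← fundamentalDomain_latticeBasisN hL]
  exact lintegral_fundamentalDomain_comp_equivariant _ volume hF hbij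
    (fun X ik => by rw [latticeBasisN_apply hL]; exact hequiv X ik.1 ik.2)
    (fun X ik => by rw [latticeBasisN_apply hL]; exact hper X ik.1 ik.2)

/-- The Jacobian of a lattice-equivariant everywhere differentiable bijection integrates over
the cell to the volume of the cell: `∫_{[0,L)^{3N}} |det F'| = L^{3N}`. [folklore] -/
theorem lintegral_cellN_abs_det_fderiv (hL : 0 < L) {F : Config N → Config N}
    {F' : Config N → (Config N →L[ℝ] Config N)} (hF : ∀ X, HasFDerivAt F (F' X) X)
    (hbij : Function.Bijective F)
    (hequiv : ∀ (X : Config N) (i : Fin N) (c : Fin 3),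
      F (X + Pi.single i (EuclideanSpace.single c L)) =
        F X + Pi.single i (EuclideanSpace.single c L)) :
    ∫⁻ X in cellN N L, ENNReal.ofReal |(F' X).det| = (ENNReal.ofReal L ^ 3) ^ N := by
  have h := lintegral_cellN_comp_equivariant hL hF hbij hequiv (G := fun _ => 1)
    (fun _ _ _ => rfl)
  simp only [one_mul, lintegral_one, Measure.restrict_apply MeasurableSet.univ, univ_inter,
    volume_cellN] at h
  exact h

/-- Transfer of integrability under the torus change of variables: for lattice-periodic `G` with
values in a real normed space, `|det F'| • (G ∘ F)` is integrable on the cell iff `G` is.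
[folklore] -/
theorem integrableOn_cellN_comp_equivariant_iff (hL : 0 < L) {F : Config N → Config N}
    {F' : Config N → (Config N →L[ℝ] Config N)} (hF : ∀ X, HasFDerivAt F (F' X) X)
    (hbij : Function.Bijective F)
    (hequiv : ∀ (X : Config N) (i : Fin N) (c : Fin 3),
      F (X + Pi.single i (EuclideanSpace.single c L)) =
        F X + Pi.single i (EuclideanSpace.single c L))
    {W : Type*} [NormedAddCommGroup W] [NormedSpace ℝ W] {G : Config N → W}
    (hper : ∀ (X : Config N) (i : Fin N) (c : Fin 3),
      G (X + Pi.single i (EuclideanSpace.single c L)) = G X) :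
    IntegrableOn (fun X => |(F' X).det| • G (F X)) (cellN N L) ↔ IntegrableOn G (cellN N L) := by
  rw [← fundamentalDomain_latticeBasisN hL]
  exact integrableOn_fundamentalDomain_comp_equivariant_iff _ volume hF hbij
    (fun X ik => by rw [latticeBasisN_apply hL]; exact hequiv X ik.1 ik.2)
    (fun X ik => by rw [latticeBasisN_apply hL]; exact hper X ik.1 ik.2)

/-- **Change of variables on the flat torus** (Bochner form). For `L > 0`, a lattice-equivariant
bijection `F` of `(ℝ³)^N` with Fréchet derivative `F' X` at every `X`, and a lattice-periodic `G`
with values in a real normed space,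
`∫_{[0,L)^{3N}} |det F'(X)| • G (F X) dX = ∫_{[0,L)^{3N}} G` (no integrability hypothesis: by
`integrableOn_cellN_comp_equivariant_iff` both sides are `0` when `G` is not integrable on the
cell). [folklore] -/
theorem integral_cellN_comp_equivariant (hL : 0 < L) {F : Config N → Config N}
    {F' : Config N → (Config N →L[ℝ] Config N)} (hF : ∀ X, HasFDerivAt F (F' X) X)
    (hbij : Function.Bijective F)
    (hequiv : ∀ (X : Config N) (i : Fin N) (c : Fin 3),
      F (X + Pi.single i (EuclideanSpace.single c L)) =
        F X + Pi.single i (EuclideanSpace.single c L))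
    {W : Type*} [NormedAddCommGroup W] [NormedSpace ℝ W] {G : Config N → W}
    (hper : ∀ (X : Config N) (i : Fin N) (c : Fin 3),
      G (X + Pi.single i (EuclideanSpace.single c L)) = G X) :
    ∫ X in cellN N L, |(F' X).det| • G (F X) = ∫ X in cellN N L, G X := by
  rw [← fundamentalDomain_latticeBasisN hL]
  exact integral_fundamentalDomain_comp_equivariant _ volume hF hbij
    (fun X ik => by rw [latticeBasisN_apply hL]; exact hequiv X ik.1 ik.2)
    (fun X ik => by rw [latticeBasisN_apply hL]; exact hper X ik.1 ik.2)

end Cell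

end Literature.MathematicalPhysics.QuantumManyBody.BoseGas
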